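import Literature.NumberTheory.GaloisRepresentations.WeakAbelianDirectSummandProofs
import HarnessLib

/-!
# Weak abelian direct summands (Böckle–Hui 2025, Thm. 1.1): closure of the conclusion under
# products and inverses, proved

Topic `NumberTheory/GaloisRepresentations`; namespace
`Literature.NumberTheory.GaloisRepresentations`.  A *proofs* file (theorems only; no definition,
no named fact), sibling of `WeakAbelianDirectSummand.lean` (the named fact
`exists_heckeCharacter_of_weaklyDivides`: Böckle–Hui Thm. 1.1 in the Hecke-character form of
BH §3.2.1) and of `WeakAbelianDirectSummandProofs.lean` (the finite-image case).

Write `C(ψ, ι, χ)` for the conclusion of the fact for a rank-one `ψ : Γ_K →ₜ* GL_1(ℚ̄_ℓ)`, a field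
isomorphism `ι : ℚ̄_ℓ ≃+* ℂ` and a Hecke character `χ`: at all but finitely many `v`, `χ` and `ψ`
are unramified and `ψ.HasFrobCharpolyAt v (X - C (ι⁻¹(χ(ϖ_v))⁻¹))` ("`ψ(Frob_v) = ι⁻¹(χ(ϖ_v))⁻¹`").
This file proves the bookkeeping half of Serre's description of the characters coming from
algebraic Hecke characters (*Abelian ℓ-adic representations* (1968), Ch. II §2.3–2.7, Ch. III
§2.3: the `ℓ`-adic characters attached to algebraic Hecke characters form a GROUP, `χ ↦ ψ_χ`
being multiplicative):

* `HeckeCharacter.IsAlgebraic.mul`, `HeckeCharacter.IsAlgebraic.inv`,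
  `HeckeCharacter.isAlgebraic_one` — algebraic Hecke characters (type `A₀`,
  `HeckeCharacter.IsAlgebraic`) form a subgroup (infinity types add).
* `FramedGaloisRep.exists_heckeCharacter_of_entry_mul` — if `C(ψ₁, ι, χ₁)` and `C(ψ₂, ι, χ₂)`
  with `χ₁, χ₂` algebraic, and `ψ` has entry `(ψ σ)₀₀ = (ψ₁ σ)₀₀ (ψ₂ σ)₀₀`, then `C(ψ, ι, χ₁χ₂)`
  with `χ₁χ₂` algebraic.
* `FramedGaloisRep.exists_heckeCharacter_of_entry_inv` — if `C(ψ, ι, χ)` with `χ` algebraic and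
  `(ψ' σ)₀₀ = (ψ σ)₀₀⁻¹`, then `C(ψ', ι, χ⁻¹)`.

Together with the finite-image case (`WeakAbelianDirectSummandProofs.lean`) and the cyclotomic
witness (`WeakAbelianDirectSummandCyclotomicProofs.lean`, `χ_ℓ ↔ ‖·‖`) this gives the conclusion
of the fact for every `ψ` of the shape `χ_ℓ^a · ε`, `a ∈ ℤ`, `ε` of finite image — all locally
algebraic characters when `K` has no CM subfield (e.g. `K` totally real, the setting of BH
Thm. 1.2).  The Galois-theoretic content of Theorem 1.1 (a weak abelian direct summand of a
semisimple `E`-rational `ρ` IS of this kind, resp. locally algebraic) is not touched here.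

## References

* G. Böckle, C.-Y. Hui, Math. Ann. 393 (2025), Thm. 1.1, §3.2.1. [BockleHui2025]
* J.-P. Serre, *Abelian ℓ-adic representations and elliptic curves* (1968), Ch. II §§2.3–2.7,
  Ch. III §2.3. [SerreAbelianLadic1968]
* A. Weil, *On a certain type of characters of the idèle-class group of an algebraic
  number-field* (1956) (characters of type `A₀` form a group).
-/

noncomputable section

open scoped NumberField Matrix
open NumberField Field IsDedekindDomain Polynomial Filter

namespace Literature.NumberTheory.GaloisRepresentations

universe u

/-! ### Algebraic Hecke characters form a group -/

namespace HeckeCharacter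

variable {K : Type u} [Field K] [NumberField K]

omit [NumberField K] in
/-- A coordinate of an infinite idele is nonzero, hence so is its image under the embedding
`ι_w : K_w → ℂ`. [folklore] -/
theorem extensionEmbedding_coe_apply_ne_zero (x : (InfiniteAdeleRing K)ˣ) (w : InfinitePlace K) :
    InfinitePlace.Completion.extensionEmbedding w ((x : InfiniteAdeleRing K) w) ≠ 0 := by
  refine (_root_.map_ne_zero _).mpr (left_ne_zero_of_mul_eq_one
    (b := ((x⁻¹ : (InfiniteAdeleRing K)ˣ) : InfiniteAdeleRing K) w) ?_)
  rw [← Pi.mul_apply]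
  change ((x * x⁻¹ : (InfiniteAdeleRing K)ˣ) : InfiniteAdeleRing K) w = 1
  rw [mul_inv_cancel, Units.val_one]
  rfl

/-- **Algebraic Hecke characters are closed under products** (infinity types add: type
`(p₁ + p₂, q₁ + q₂)` on `U₁ ∩ U₂`).  Ref: Weil (1956); Serre (1968), Ch. II §2.4. [folklore] -/
theorem IsAlgebraic.mul {χ₁ χ₂ : HeckeCharacter K} (h₁ : χ₁.IsAlgebraic) (h₂ : χ₂.IsAlgebraic) :
    (χ₁ * χ₂).IsAlgebraic := by
  obtain ⟨p₁, q₁, U₁, hU₁, h₁⟩ := h₁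
  obtain ⟨p₂, q₂, U₂, hU₂, h₂⟩ := h₂
  refine ⟨p₁ + p₂, q₁ + q₂, U₁ ∩ U₂, Filter.inter_mem hU₁ hU₂, fun x hx => ?_⟩
  rw [mul_apply, Units.val_mul, h₁ x hx.1, h₂ x hx.2, ← Finset.prod_mul_distrib]
  refine Finset.prod_congr rfl fun w _ => ?_
  have hE := extensionEmbedding_coe_apply_ne_zero x w
  have hEc : (starRingEnd ℂ)
      (InfinitePlace.Completion.extensionEmbedding w ((x : InfiniteAdeleRing K) w)) ≠ 0 :=
    (_root_.map_ne_zero _).mpr hE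
  simp only [Pi.add_apply, neg_add]
  rw [zpow_add₀ hE, zpow_add₀ hEc]
  ring

/-- **Algebraic Hecke characters are closed under inverses** (type `(-p, -q)` on the same `U`).
Ref: Weil (1956); Serre (1968), Ch. II §2.4. [folklore] -/
theorem IsAlgebraic.inv {χ : HeckeCharacter K} (h : χ.IsAlgebraic) : χ⁻¹.IsAlgebraic := by
  obtain ⟨p, q, U, hU, h⟩ := h
  refine ⟨-p, -q, U, hU, fun x hx => ?_⟩
  rw [inv_apply, Units.val_inv_eq_inv_val, h x hx, ← Finset.prod_inv_distrib]
  refine Finset.prod_congr rfl fun w _ => ?_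
  simp only [Pi.neg_apply, neg_neg, mul_inv, ← zpow_neg]

/-- The trivial Hecke character is algebraic (it has finite order). [folklore] -/
theorem isAlgebraic_one : (1 : HeckeCharacter K).IsAlgebraic :=
  IsFiniteOrder.isAlgebraic (χ := 1) IsOfFinOrder.one

end HeckeCharacter

/-! ### The conclusion of Theorem 1.1 is multiplicative in `ψ` -/

namespace FramedGaloisRep

variable {K : Type} [Field K] [NumberField K] {ℓ : ℕ} [Fact ℓ.Prime]

/-- **Products.**  Let `ψ, ψ₁, ψ₂ : Γ_K →ₜ* GL_1(ℚ̄_ℓ)` with `(ψ σ)₀₀ = (ψ₁ σ)₀₀ (ψ₂ σ)₀₀` for all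
`σ`, and `ι : ℚ̄_ℓ ≃+* ℂ`.  If the conclusion of `exists_heckeCharacter_of_weaklyDivides` holds
for `ψ₁` and for `ψ₂` (with algebraic Hecke characters `χ₁`, `χ₂`: at almost all `v`, unramified
and `ψ_i(Frob_v) = ι⁻¹(χ_i(ϖ_v))⁻¹`), then it holds for `ψ` with the algebraic Hecke character
`χ₁ χ₂`: at almost all `v`, `χ₁χ₂` and `ψ` are unramified and
`ψ(Frob_v) = ι⁻¹((χ₁χ₂)(ϖ_v))⁻¹` (entries, local components and `χ(ϖ_v)` are multiplicative).
Ref: Serre (1968), Ch. II §2.3–2.5 (`χ ↦ ψ_χ` is a homomorphism).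
[cite: SerreAbelianLadic1968, Ch. II §2.5] -/
theorem exists_heckeCharacter_of_entry_mul (ψ ψ₁ ψ₂ : FramedGaloisRep K (PadicAlgCl ℓ) 1)
    (hmul : ∀ σ : absoluteGaloisGroup K,
      ((ψ σ : GL (Fin 1) (PadicAlgCl ℓ)) : Matrix (Fin 1) (Fin 1) (PadicAlgCl ℓ)) 0 0 =
        ((ψ₁ σ : GL (Fin 1) (PadicAlgCl ℓ)) : Matrix (Fin 1) (Fin 1) (PadicAlgCl ℓ)) 0 0 *
          ((ψ₂ σ : GL (Fin 1) (PadicAlgCl ℓ)) : Matrix (Fin 1) (Fin 1) (PadicAlgCl ℓ)) 0 0)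
    (ι : PadicAlgCl ℓ ≃+* ℂ)
    (h₁ : ∃ χ₁ : HeckeCharacter K, χ₁.IsAlgebraic ∧
      ∀ᶠ v : HeightOneSpectrum (𝓞 K) in cofinite, χ₁.IsUnramifiedAt v ∧ ψ₁.IsUnramifiedAt v ∧
        ψ₁.HasFrobCharpolyAt v (X - C (ι.symm (χ₁.valueAtUniformizer v)⁻¹)))
    (h₂ : ∃ χ₂ : HeckeCharacter K, χ₂.IsAlgebraic ∧
      ∀ᶠ v : HeightOneSpectrum (𝓞 K) in cofinite, χ₂.IsUnramifiedAt v ∧ ψ₂.IsUnramifiedAt v ∧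
        ψ₂.HasFrobCharpolyAt v (X - C (ι.symm (χ₂.valueAtUniformizer v)⁻¹))) :
    ∃ χ : HeckeCharacter K, χ.IsAlgebraic ∧
      ∀ᶠ v : HeightOneSpectrum (𝓞 K) in cofinite, χ.IsUnramifiedAt v ∧ ψ.IsUnramifiedAt v ∧
        ψ.HasFrobCharpolyAt v (X - C (ι.symm (χ.valueAtUniformizer v)⁻¹)) := by
  obtain ⟨χ₁, hχ₁, h₁⟩ := h₁
  obtain ⟨χ₂, hχ₂, h₂⟩ := h₂
  refine ⟨χ₁ * χ₂, hχ₁.mul hχ₂, (h₁.and h₂).mono fun v hv => ?_⟩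
  obtain ⟨⟨hu₁, hr₁, hf₁⟩, ⟨hu₂, hr₂, hf₂⟩⟩ := hv
  refine ⟨fun u => ?_, fun 𝔓 h𝔓 σ hσ => ?_, ?_⟩
  · -- local components are multiplicative
    change χ₁.localComponent v _ * χ₂.localComponent v _ = 1
    rw [hu₁ u, hu₂ u, one_mul]
  · -- a `1 × 1` invertible matrix with entry `1 · 1` is `1`
    have h := hmul σ
    rw [hr₁ 𝔓 h𝔓 σ hσ, hr₂ 𝔓 h𝔓 σ hσ] at h
    refine Units.ext (Matrix.ext fun i j => ?_)
    rw [Subsingleton.elim i 0, Subsingleton.elim j 0, h]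
    simp
  · have e₁ := (hasFrobCharpolyAt_iff_of_rank_one ψ₁ v _).mp hf₁
    have e₂ := (hasFrobCharpolyAt_iff_of_rank_one ψ₂ v _).mp hf₂
    refine (hasFrobCharpolyAt_iff_of_rank_one ψ v _).mpr fun 𝔓 h𝔓 Φ hΦ => ?_
    have hval : (χ₁ * χ₂).valueAtUniformizer v =
        χ₁.valueAtUniformizer v * χ₂.valueAtUniformizer v := by
      simp only [HeckeCharacter.valueAtUniformizer, HeckeCharacter.localComponent_apply,
        HeckeCharacter.mul_apply, Units.val_mul]
    rw [hmul Φ, e₁ 𝔓 h𝔓 Φ hΦ, e₂ 𝔓 h𝔓 Φ hΦ, hval, mul_inv, map_mul]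

/-- **Inverses.**  If the conclusion of `exists_heckeCharacter_of_weaklyDivides` holds for
`ψ : Γ_K →ₜ* GL_1(ℚ̄_ℓ)` and `ι` with the algebraic Hecke character `χ`, and `ψ'` has entry
`(ψ' σ)₀₀ = (ψ σ)₀₀⁻¹`, then it holds for `ψ'` with the algebraic Hecke character `χ⁻¹`.
Ref: Serre (1968), Ch. II §2.3–2.5. [cite: SerreAbelianLadic1968, Ch. II §2.5] -/
theorem exists_heckeCharacter_of_entry_inv (ψ' ψ : FramedGaloisRep K (PadicAlgCl ℓ) 1)
    (hinv : ∀ σ : absoluteGaloisGroup K,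
      ((ψ' σ : GL (Fin 1) (PadicAlgCl ℓ)) : Matrix (Fin 1) (Fin 1) (PadicAlgCl ℓ)) 0 0 =
        (((ψ σ : GL (Fin 1) (PadicAlgCl ℓ)) : Matrix (Fin 1) (Fin 1) (PadicAlgCl ℓ)) 0 0)⁻¹)
    (ι : PadicAlgCl ℓ ≃+* ℂ)
    (h : ∃ χ : HeckeCharacter K, χ.IsAlgebraic ∧
      ∀ᶠ v : HeightOneSpectrum (𝓞 K) in cofinite, χ.IsUnramifiedAt v ∧ ψ.IsUnramifiedAt v ∧
        ψ.HasFrobCharpolyAt v (X - C (ι.symm (χ.valueAtUniformizer v)⁻¹))) :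
    ∃ χ : HeckeCharacter K, χ.IsAlgebraic ∧
      ∀ᶠ v : HeightOneSpectrum (𝓞 K) in cofinite, χ.IsUnramifiedAt v ∧ ψ'.IsUnramifiedAt v ∧
        ψ'.HasFrobCharpolyAt v (X - C (ι.symm (χ.valueAtUniformizer v)⁻¹)) := by
  obtain ⟨χ, hχ, h⟩ := h
  refine ⟨χ⁻¹, hχ.inv, h.mono fun v hv => ?_⟩
  obtain ⟨hu, hr, hf⟩ := hv
  refine ⟨HeckeCharacter.isUnramifiedAt_inv_iff.mpr hu, fun 𝔓 h𝔓 σ hσ => ?_, ?_⟩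
  · have h := hinv σ
    rw [hr 𝔓 h𝔓 σ hσ] at h
    refine Units.ext (Matrix.ext fun i j => ?_)
    rw [Subsingleton.elim i 0, Subsingleton.elim j 0, h]
    simp
  · have e := (hasFrobCharpolyAt_iff_of_rank_one ψ v _).mp hf
    refine (hasFrobCharpolyAt_iff_of_rank_one ψ' v _).mpr fun 𝔓 h𝔓 Φ hΦ => ?_
    rw [hinv Φ, e 𝔓 h𝔓 Φ hΦ, HeckeCharacter.valueAtUniformizer_inv, inv_inv, map_inv₀, inv_inv]

end FramedGaloisRep

end Literature.NumberTheory.GaloisRepresentations
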